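import Summits.QuantumFields.YangMills.Theorems.AlphaInputsT3ACv3AxialLine
import Summits.QuantumFields.YangMills.Theorems.AlphaInputsT3ACv3SectionChart
import Summits.QuantumFields.YangMills.Theorems.UnitScaleTiltProp7AxialLemma1
import HarnessLib

/-!
# `AlphaInputsT3ACv3StartDefectTwoCell` — non-abelian (FL), START v3 row (S6), THE TWO-CELL GEOMETRY: **the torus-form binders `hwrap`, `hfan`, `hl1`, `hW` of the box theorem
# `StartDefectBox.norm_startDefect_sub_one_le_of_box`, discharged once and for all for every level-`k` bond `c`** (no region needed) — the two `k`-blocks of `c` lie in the explicit product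
# set `Π_κ I_κ`, `I_κ = {first label of the block of c₋ in direction κ} + [0, Lᵏ−1]` (`[0, 2Lᵏ−1]` for `κ = c.dir`), their comb fans from the centre `ĉ₋` stay inside it without wrapping when
# `4Lᵏ ≤ sitesPerDir 0`, the `l¹`-radius is `≤ d·⌊Lᵏ/2⌋ + Lᵏ`, and the SECTION `iterSec k V` is FLAT there (a special plaquette needs two LAST in-plane labels; a last label transverse to
# `c.dir` pushes the opposite corner out of the one-block window) — so the (S6) defect bound needs from (S5) ONLY the plaquettes of the START on that box and its quietness on the centre
# line — cell `ym3-torus`, width seat `ym-ust-19936-w5` (g2), row (S6) of ★w1-19936 g2 LEAD memo §3 (D)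

WHAT.  §1 labels: `blockStart`, `twoCellSet` (defs), `val_toFine_eq_blockStart` (`ĉ₋_κ = start_κ + ⌊Lᵏ/2⌋`), ★ `exists_offset_of_mem_blocks` (a fine site of the two blocks reads
`start_κ + u_κ`, `u_κ ≤ Lᵏ−1` resp. `≤ 2Lᵏ−1` in direction `c.dir` — `val_iterBlockOf`, the wrap at the last coarse label absorbed through `sitesPerDir 0 = sitesPerDir k·Lᵏ`),
`rel_toFine_eq_of_offset` (`rel ĉ₋ x κ = u_κ − ⌊Lᵏ/2⌋`, `ZMod.valMinAbs_spec`); §2 the four binders: `hwrap_twoCell`, `hl1_twoCell`, `hfan_twoCell`; §3 `val_mod_of_mem_twoCellSet`,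
`not_last_of_mem`, ★★ `plaqHol_iterSec_eq_one_of_twoCell` (`hW`); §4 ★★★ `norm_startDefect_sub_one_le_twoCell`.
HONEST FRAMING.  Torus-label bookkeeping; count-neutral helper toward R3 2′ (items 19936∕19935, `--supports stmt-QuantumFields-19936`); `hLift`∕(FL), the stub, the crux and the gap are NOT
claimed; registry untouched; YM₃ on T³ is rung R3 of the YM ladder, not the Clay problem.

References: T. Bałaban, Commun. Math. Phys. 109 (1987) 249–301 [Balaban1987RG1] ((0.1) p.251, (0.11) p.253); Commun. Math. Phys. 98 (1985) 17–51 [Balaban1985Averaging] (pp.24–25);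
Commun. Math. Phys. 102 (1985) 277–309 [Balaban1985Variational] ((11)–(13) pp.279–280).
-/

set_option autoImplicit false

open scoped Matrix.Norms.L2Operator

namespace Summit.QuantumFields.YangMills.Theorems.StartDefectBox

open Literature.MathematicalPhysics.QuantumFieldTheory.Balaban1983to89
open T4Continuum BlockAveraging ExpMeanLog BlockAveragingEMLLinearised
open Literature.MathematicalPhysics.QuantumFieldTheory.Balaban1983to89.BlockAveragingSectionAction (iterSec)
open Summit.QuantumFields.Balaban3D.Carriers (coarsen)
open Literature.MathematicalPhysics.QuantumFieldTheory.Balaban1983to89.B5Eq118OneStroke (iterBlockOf val_iterBlockOf)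
open Literature.MathematicalPhysics.QuantumFieldTheory.Balaban1983to89.B10Eq38TorusDomains (toFine)
open Literature.MathematicalPhysics.QuantumFieldTheory.Balaban1983to89.B10Eq27TorusAxialLog (rel rel_apply rel_shift_of_le)
open Literature.MathematicalPhysics.QuantumFieldTheory.Balaban1983to89.B7Prop1Explicit (l1 e e_apply)
open Summit.QuantumFields.YangMills.Theorems.LinearLiftSpread (val_toFine)
open Summit.QuantumFields.YangMills.Theorems.Prop7FlatHolonomy (sitesPerDir_zero_eq_mul_pow)

variable {P : Params}

/-! ## §1 Labels of the two blocks of a coarse bond -/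

section Labels

variable {k : ℕ}

/-- The FIRST fine label of the `k`-block of `c₋` in direction `κ`, as a torus coordinate: `(c₋)_κ · Lᵏ`. [cite: Balaban1987RG1, (0.1) p.251] -/
def blockStart (k : ℕ) (c : PBond P k) (κ : Fin P.d) : ZMod (P.sitesPerDir 0) := (((c.src κ).val * P.L ^ k : ℕ) : ZMod (P.sitesPerDir 0))

/-- The width of the two-cell window in direction `κ`: `2Lᵏ − 1` along `c`, `Lᵏ − 1` across. [folklore] -/
def winHi (k : ℕ) (c : PBond P k) (κ : Fin P.d) : ℕ := if κ = c.dir then 2 * P.L ^ k - 1 else P.L ^ k - 1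

/-- **THE TWO-CELL PRODUCT SET** of `c`: in direction `κ` the labels `start_κ + u`, `0 ≤ u ≤ winHi κ`. [cite: Balaban1987RG1, (0.1) p.251] -/
def twoCellSet (k : ℕ) (c : PBond P k) (κ : Fin P.d) : Set (ZMod (P.sitesPerDir 0)) :=
  {z | ∃ u : ℕ, u ≤ winHi k c κ ∧ z = blockStart k c κ + ((u : ℕ) : ZMod (P.sitesPerDir 0))}

/-- The centre reads `ĉ₋_κ = start_κ + ⌊Lᵏ/2⌋`. [cite: Balaban1987RG1, (0.1) p.251] -/
theorem toFine_src_eq_blockStart (hk : k ≤ P.m + P.K) (c : PBond P k) (κ : Fin P.d) :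
    (toFine k c.src) κ = blockStart k c κ + ((P.L ^ k / 2 : ℕ) : ZMod (P.sitesPerDir 0)) := by
  rw [← ZMod.natCast_zmod_val ((toFine k c.src) κ), val_toFine k hk, blockStart, ← Nat.cast_add]

/-- **★ THE OFFSET OF A FINE SITE OF THE TWO BLOCKS**: if `iterBlockOf k x ∈ {c₋, c₊}` then in every direction `x_κ = start_κ + u_κ` with `u_κ ≤ winHi κ`; precisely
`u_κ = j·Lᵏ + (x_κ mod Lᵏ)` with `j = 1` exactly when `x` lies over `c₊` and `κ = c.dir` (the wrap at the last coarse label is absorbed by `sitesPerDir 0 = sitesPerDir k · Lᵏ`).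
[cite: Balaban1987RG1, (0.1) p.251] -/
theorem exists_offset_of_mem_blocks (hk : k ≤ P.m + P.K) (c : PBond P k) (x : Site P 0) (hx : iterBlockOf k x = c.src ∨ iterBlockOf k x = c.tgt) (κ : Fin P.d) :
    ∃ j : ℕ, j ≤ 1 ∧ (j = 1 → κ = c.dir ∧ iterBlockOf k x = c.tgt) ∧
      x κ = blockStart k c κ + (((j * P.L ^ k + (x κ).val % P.L ^ k : ℕ) : ℕ) : ZMod (P.sitesPerDir 0)) := by
  have hN : P.sitesPerDir 0 = P.sitesPerDir k * P.L ^ k := sitesPerDir_zero_eq_mul_pow hk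
  have hdm : P.L ^ k * ((x κ).val / P.L ^ k) + (x κ).val % P.L ^ k = (x κ).val := Nat.div_add_mod _ _
  have hq : (x κ).val / P.L ^ k = ((iterBlockOf k x) κ).val := (val_iterBlockOf k hk x κ).symm
  -- which block, which direction
  have hcase : ((iterBlockOf k x) κ).val = (c.src κ).val ∨ (κ = c.dir ∧ iterBlockOf k x = c.tgt ∧ ((iterBlockOf k x) κ).val = ((c.src κ).val + 1) % P.sitesPerDir k) := by
    rcases hx with h | h
    · exact Or.inl (by rw [h])
    · by_cases hκ : κ = c.dir
      · right
        refine ⟨hκ, h, ?_⟩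
        rw [h, show c.tgt = c.src.shift c.dir from rfl, hκ, B10StarCount.shift_apply_self, ZMod.val_add, ZMod.val_one_eq_one_mod, Nat.add_mod_mod]
      · left
        rw [h, show c.tgt = c.src.shift c.dir from rfl, B10StarCount.shift_apply_ne _ hκ]
  rcases hcase with h0 | ⟨hκ, ht, h1⟩
  · refine ⟨0, by omega, fun h => absurd h (by omega), ?_⟩
    refine (ZMod.natCast_zmod_val (x κ)).symm.trans ?_
    rw [blockStart, ← Nat.cast_add]
    congr 1
    have hdm' : (x κ).val / P.L ^ k * P.L ^ k + (x κ).val % P.L ^ k = (x κ).val := Nat.div_add_mod' _ _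
    rw [hq, h0] at hdm'
    omega
  · refine ⟨1, le_rfl, fun _ => ⟨hκ, ht⟩, ?_⟩
    refine (ZMod.natCast_zmod_val (x κ)).symm.trans ?_
    rw [blockStart, ← Nat.cast_add]
    -- `x_κ = q·Lᵏ + s` with `q = (a+1) mod n_k`; `q·Lᵏ ≡ (a+1)·Lᵏ (mod n_0 = n_k·Lᵏ)`
    have hdm' : (x κ).val / P.L ^ k * P.L ^ k + (x κ).val % P.L ^ k = (x κ).val := Nat.div_add_mod' _ _
    rw [hq, h1] at hdm'
    have key : ∀ (a q r N0 Nk Lk : ℕ), N0 = Nk * Lk → q = (a + 1) % Nk → (q * Lk + r) % N0 = (a * Lk + (1 * Lk + r)) % N0 := by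
      intro a q r N0 Nk Lk hN0 hq'
      subst hN0; subst hq'
      rw [← Nat.mul_mod_mul_right, Nat.mod_add_mod]
      congr 1; ring
    have hmodeq : (x κ).val % P.sitesPerDir 0 = ((c.src κ).val * P.L ^ k + (1 * P.L ^ k + (x κ).val % P.L ^ k)) % P.sitesPerDir 0 := by
      conv_lhs => rw [← hdm']
      exact key _ _ _ _ _ _ hN rfl
    exact (ZMod.natCast_eq_natCast_iff' _ _ _).mpr hmodeq

/-- The offset bound: `j·Lᵏ + s ≤ winHi κ`. [folklore] -/
theorem offset_le_winHi (c : PBond P k) (κ : Fin P.d) {j s : ℕ} (hj : j ≤ 1) (hjd : j = 1 → κ = c.dir) (hs : s < P.L ^ k) :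
    j * P.L ^ k + s ≤ winHi k c κ := by
  unfold winHi
  by_cases hκ : κ = c.dir
  · rw [if_pos hκ]
    rcases Nat.le_one_iff_eq_zero_or_eq_one.mp hj with rfl | rfl <;> omega
  · rw [if_neg hκ]
    have : j = 0 := by
      rcases Nat.le_one_iff_eq_zero_or_eq_one.mp hj with rfl | rfl
      · rfl
      · exact absurd (hjd rfl) hκ
    subst this; omega

/-- **A FINE SITE OF THE TWO BLOCKS LIES IN THE TWO-CELL PRODUCT SET.** [cite: Balaban1987RG1, (0.1) p.251] -/
theorem mem_twoCellSet_of_mem_blocks (hk : k ≤ P.m + P.K) (c : PBond P k) (x : Site P 0) (hx : iterBlockOf k x = c.src ∨ iterBlockOf k x = c.tgt) (κ : Fin P.d) :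
    x κ ∈ twoCellSet k c κ := by
  obtain ⟨j, hj, hjd, hxκ⟩ := exists_offset_of_mem_blocks hk c x hx κ
  exact ⟨j * P.L ^ k + (x κ).val % P.L ^ k, offset_le_winHi c κ hj (fun h => (hjd h).1) (Nat.mod_lt _ (pow_pos P.L_pos k)), hxκ⟩

/-- **THE RELATIVE POSITION FROM THE CENTRE, FROM THE OFFSET** (`4Lᵏ ≤ sitesPerDir 0`: no wrap): if `x_κ = start_κ + u` with `u ≤ 2Lᵏ − 1` then `rel ĉ₋ x κ = u − ⌊Lᵏ/2⌋`.
[cite: Balaban1985Averaging, pp.24–25] -/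
theorem rel_toFine_eq_of_offset (hk : k ≤ P.m + P.K) (hN4 : 4 * P.L ^ k ≤ P.sitesPerDir 0) (c : PBond P k) (x : Site P 0) (κ : Fin P.d) {u : ℕ} (hu : u ≤ 2 * P.L ^ k - 1)
    (hx : x κ = blockStart k c κ + ((u : ℕ) : ZMod (P.sitesPerDir 0))) :
    rel (toFine k c.src) x κ = (u : ℤ) - ((P.L ^ k / 2 : ℕ) : ℤ) := by
  rw [rel_apply]
  set Lk := P.L ^ k with hLk
  refine (ZMod.valMinAbs_spec _ _).mpr ⟨?_, ?_⟩
  · rw [hx, toFine_src_eq_blockStart hk, ← hLk, Int.cast_sub, Int.cast_natCast, Int.cast_natCast]; abel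
  · have h2 : Lk = 2 * (Lk / 2) + 1 := TubeStart.pow_eq_two_mul_half_add_one (P := P) k
    have hpos : 0 < P.sitesPerDir 0 := Nat.pos_of_ne_zero (P.sitesPerDir_ne_zero 0)
    constructor <;> omega

end Labels

/-! ## §2 The binders `hwrap`, `hl1`, `hfan` of the box theorem -/

section Binders

variable {k : ℕ}

/-- The window of the relative position: `−⌊Lᵏ/2⌋ ≤ rel ĉ₋ x κ ≤ winHi κ − ⌊Lᵏ/2⌋` on the two blocks. [cite: Balaban1985Averaging, pp.24–25] -/
theorem rel_window (hk : k ≤ P.m + P.K) (hN4 : 4 * P.L ^ k ≤ P.sitesPerDir 0) (c : PBond P k) (x : Site P 0) (hx : iterBlockOf k x = c.src ∨ iterBlockOf k x = c.tgt)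
    (κ : Fin P.d) : -((P.L ^ k / 2 : ℕ) : ℤ) ≤ rel (toFine k c.src) x κ ∧ rel (toFine k c.src) x κ ≤ (winHi k c κ : ℤ) - ((P.L ^ k / 2 : ℕ) : ℤ) := by
  obtain ⟨j, hj, hjd, hxκ⟩ := exists_offset_of_mem_blocks hk c x hx κ
  have hs : (x κ).val % P.L ^ k < P.L ^ k := Nat.mod_lt _ (pow_pos P.L_pos k)
  have hwin := offset_le_winHi c κ hj (fun h => (hjd h).1) hs
  have hu2 : j * P.L ^ k + (x κ).val % P.L ^ k ≤ 2 * P.L ^ k - 1 := by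
    refine hwin.trans ?_
    unfold winHi; split_ifs <;> omega
  rw [rel_toFine_eq_of_offset hk hN4 c x κ hu2 hxκ]
  set r := (x κ).val % P.L ^ k with hr
  set Lk := P.L ^ k with hLk
  constructor <;> omega

/-- **`hwrap`**: `(rel ĉ₋ x μ + 1)·2 ≤ sitesPerDir 0` on the two blocks (`4Lᵏ ≤ sitesPerDir 0`). [cite: Balaban1985Averaging, pp.24–25] -/
theorem hwrap_twoCell (hk : k ≤ P.m + P.K) (hN4 : 4 * P.L ^ k ≤ P.sitesPerDir 0) (c : PBond P k) (x : Site P 0) (hx : iterBlockOf k x = c.src ∨ iterBlockOf k x = c.tgt)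
    (μ : Fin P.d) : (rel (toFine k c.src) x μ + 1) * 2 ≤ (P.sitesPerDir 0 : ℤ) := by
  have h := (rel_window hk hN4 c x hx μ).2
  set Lk := P.L ^ k with hLk
  have hw : winHi k c μ ≤ 2 * Lk - 1 := by unfold winHi; split_ifs <;> omega
  have h2 : Lk = 2 * (Lk / 2) + 1 := TubeStart.pow_eq_two_mul_half_add_one (P := P) k
  omega

/-- **`hl1`**: `l1 (rel ĉ₋ x) ≤ d·⌊Lᵏ/2⌋ + Lᵏ` on the two blocks. [cite: Balaban1985Averaging, pp.24–25] -/
theorem hl1_twoCell (hk : k ≤ P.m + P.K) (hN4 : 4 * P.L ^ k ≤ P.sitesPerDir 0) (c : PBond P k) (x : Site P 0) (hx : iterBlockOf k x = c.src ∨ iterBlockOf k x = c.tgt) :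
    l1 (rel (toFine k c.src) x) ≤ P.d * (P.L ^ k / 2) + P.L ^ k := by
  unfold l1
  have hb : ∀ κ, (rel (toFine k c.src) x κ).natAbs ≤ P.L ^ k / 2 + (if κ = c.dir then P.L ^ k else 0) := fun κ => by
    have hw := rel_window hk hN4 c x hx κ
    set Lk := P.L ^ k with hLk
    have h2 : Lk = 2 * (Lk / 2) + 1 := TubeStart.pow_eq_two_mul_half_add_one (P := P) k
    unfold winHi at hw
    split_ifs at hw ⊢ <;> omega
  calc ∑ κ, (rel (toFine k c.src) x κ).natAbs ≤ ∑ κ : Fin P.d, (P.L ^ k / 2 + (if κ = c.dir then P.L ^ k else 0)) := Finset.sum_le_sum fun κ _ => hb κ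
    _ = P.d * (P.L ^ k / 2) + P.L ^ k := by
        rw [Finset.sum_add_distrib, Finset.sum_const, Finset.card_univ, Fintype.card_fin, smul_eq_mul, Finset.sum_ite_eq' Finset.univ c.dir]
        simp

/-- **`hfan`**: the comb fan of a bond of the two blocks stays in the two-cell product set. [cite: Balaban1985Averaging, pp.24–25] -/
theorem hfan_twoCell (hk : k ≤ P.m + P.K) (hN4 : 4 * P.L ^ k ≤ P.sitesPerDir 0) (c : PBond P k) (x : Site P 0) (hx : iterBlockOf k x = c.src ∨ iterBlockOf k x = c.tgt)
    (μ : Fin P.d) (hxμ : iterBlockOf k (x.shift μ) = c.src ∨ iterBlockOf k (x.shift μ) = c.tgt) (κ : Fin P.d) (t : ℤ)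
    (ht1 : min 0 (min (rel (toFine k c.src) x κ) ((rel (toFine k c.src) x + e μ) κ)) ≤ t)
    (ht2 : t ≤ max 0 (max (rel (toFine k c.src) x κ) ((rel (toFine k c.src) x + e μ) κ))) :
    (toFine k c.src) κ + ((t : ℤ) : ZMod (P.sitesPerDir 0)) ∈ twoCellSet k c κ := by
  have hw := rel_window hk hN4 c x hx κ
  have hw' := rel_window hk hN4 c (x.shift μ) hxμ κ
  rw [rel_shift_of_le _ _ _ (hwrap_twoCell hk hN4 c x hx μ)] at hw'
  have h2 := TubeStart.pow_eq_two_mul_half_add_one (P := P) k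
  -- `−h ≤ t ≤ winHi κ − h`
  have hlo : -((P.L ^ k / 2 : ℕ) : ℤ) ≤ t := by
    have : -((P.L ^ k / 2 : ℕ) : ℤ) ≤ min 0 (min (rel (toFine k c.src) x κ) ((rel (toFine k c.src) x + e μ) κ)) :=
      le_min (by omega) (le_min hw.1 hw'.1)
    linarith
  have hhi : t ≤ (winHi k c κ : ℤ) - ((P.L ^ k / 2 : ℕ) : ℤ) := by
    have hw0 : (0 : ℤ) ≤ (winHi k c κ : ℤ) - ((P.L ^ k / 2 : ℕ) : ℤ) := by
      have : P.L ^ k / 2 ≤ winHi k c κ := by unfold winHi; split_ifs <;> omega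
      have : ((P.L ^ k / 2 : ℕ) : ℤ) ≤ (winHi k c κ : ℤ) := by exact_mod_cast this
      linarith
    have : max 0 (max (rel (toFine k c.src) x κ) ((rel (toFine k c.src) x + e μ) κ)) ≤ (winHi k c κ : ℤ) - ((P.L ^ k / 2 : ℕ) : ℤ) :=
      max_le hw0 (max_le hw.2 hw'.2)
    linarith
  obtain ⟨u, hu⟩ : ∃ u : ℕ, (u : ℤ) = t + ((P.L ^ k / 2 : ℕ) : ℤ) := ⟨(t + ((P.L ^ k / 2 : ℕ) : ℤ)).toNat, by omega⟩
  refine ⟨u, by omega, ?_⟩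
  rw [toFine_src_eq_blockStart hk, add_assoc]
  congr 1
  have e : (((P.L ^ k / 2 : ℕ) : ℤ) : ZMod (P.sitesPerDir 0)) + ((t : ℤ) : ZMod (P.sitesPerDir 0)) = (((u : ℕ) : ℤ) : ZMod (P.sitesPerDir 0)) := by
    rw [← Int.cast_add, hu, add_comm]
  rw [Int.cast_natCast, Int.cast_natCast] at e
  exact e

end Binders

/-! ## §3 The section is FLAT on the two-cell box -/

section Flat

variable {k : ℕ}

/-- The residue modulo `Lᵏ` of a label of the window: `(start_κ + u).val mod Lᵏ = u mod Lᵏ` (`sitesPerDir 0` is a multiple of `Lᵏ`). [cite: Balaban1987RG1, (0.1) p.251] -/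
theorem val_blockStart_add_mod (hk : k ≤ P.m + P.K) (c : PBond P k) (κ : Fin P.d) (u : ℕ) :
    (blockStart k c κ + ((u : ℕ) : ZMod (P.sitesPerDir 0))).val % P.L ^ k = u % P.L ^ k := by
  have hN : P.sitesPerDir 0 = P.sitesPerDir k * P.L ^ k := sitesPerDir_zero_eq_mul_pow hk
  rw [blockStart, ← Nat.cast_add, ZMod.val_natCast, Nat.mod_mod_of_dvd _ (hN ▸ Dvd.intro_left _ rfl), add_comm ((c.src κ).val * P.L ^ k) u,
    Nat.add_mul_mod_self_right]

/-- **NOT A LAST LABEL**: if `z` and `z + 1` both lie in the ONE-block window of a direction `κ ≠ c.dir`, then `z` is not a last label of its block (`z.val mod Lᵏ ≠ Lᵏ − 1`).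
[cite: Balaban1985Variational, (11) p.279] -/
theorem not_last_of_mem_twoCellSet (hk : k ≤ P.m + P.K) (hN4 : 4 * P.L ^ k ≤ P.sitesPerDir 0) (c : PBond P k) {κ : Fin P.d} (hκ : κ ≠ c.dir)
    {z : ZMod (P.sitesPerDir 0)} (hz : z ∈ twoCellSet k c κ) (hz1 : z + 1 ∈ twoCellSet k c κ) : z.val % P.L ^ k ≠ P.L ^ k - 1 := by
  obtain ⟨u, hu, rfl⟩ := hz
  obtain ⟨u', hu', he⟩ := hz1
  have hw : winHi k c κ = P.L ^ k - 1 := by unfold winHi; rw [if_neg hκ]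
  rw [hw] at hu hu'
  have hpos : 0 < P.L ^ k := pow_pos P.L_pos k
  -- `u + 1 = u'` as naturals (both below the period)
  have he' : (((u + 1 : ℕ) : ℕ) : ZMod (P.sitesPerDir 0)) = ((u' : ℕ) : ZMod (P.sitesPerDir 0)) := by
    have := he; rw [add_assoc, ← Nat.cast_one, ← Nat.cast_add] at this; exact add_left_cancel this
  have hmod := (ZMod.natCast_eq_natCast_iff' _ _ _).mp he'
  rw [Nat.mod_eq_of_lt (by omega), Nat.mod_eq_of_lt (by omega)] at hmod
  rw [val_blockStart_add_mod hk c κ u, Nat.mod_eq_of_lt (by omega)]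
  omega

/-- `((x + e_μ) + e_ν)_μ = x_μ + 1` for `μ ≠ ν`. [folklore] -/
theorem shift_shift_apply_left {j : ℕ} (x : Site P j) {μ ν : Fin P.d} (h : μ ≠ ν) : ((x.shift μ).shift ν) μ = x μ + 1 := by
  rw [B10StarCount.shift_apply_ne _ h, B10StarCount.shift_apply_self]

/-- `((x + e_μ) + e_ν)_ν = x_ν + 1` for `μ ≠ ν`. [folklore] -/
theorem shift_shift_apply_right {j : ℕ} (x : Site P j) {μ ν : Fin P.d} (h : μ ≠ ν) : ((x.shift μ).shift ν) ν = x ν + 1 := by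
  rw [B10StarCount.shift_apply_self, B10StarCount.shift_apply_ne _ (Ne.symm h)]

variable {G : Type*} [GaugeGroup G]

/-- **★★ THE SECTION IS FLAT ON THE TWO-CELL BOX**: every finest plaquette whose lower and upper corners lie in the two-cell product set of `c` has trivial holonomy under `iterSec k V` —
a special plaquette of the section needs its TWO in-plane lower labels to be last labels (★LEAD's `iterSec_apply`), and at least one in-plane direction is transverse to `c`, where the
one-block window forbids a last label below an in-box upper corner. [cite: Balaban1985Variational, (11)–(13) pp.279–280; Balaban1987RG1, (0.11) p.253] -/
theorem plaqHol_iterSec_eq_one_of_twoCell (hk : k ≤ P.m + P.K) (hN4 : 4 * P.L ^ k ≤ P.sitesPerDir 0) (c : PBond P k) (V : GaugeField P k G) (q : Plaq P 0)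
    (h1 : ∀ κ, q.src κ ∈ twoCellSet k c κ) (h2 : ∀ κ, ((q.src.shift q.μ).shift q.ν) κ ∈ twoCellSet k c κ) :
    GaugeField.plaqHol (iterSec k V) q = 1 := by
  have hμν : q.μ ≠ q.ν := ne_of_lt q.hμν
  -- a transverse in-plane direction carries no last label at the lower corner
  have hnl : ∀ κ, κ ≠ c.dir → (κ = q.μ ∨ κ = q.ν) → (q.src κ).val % P.L ^ k ≠ P.L ^ k - 1 := by
    intro κ hκ hin
    refine not_last_of_mem_twoCellSet hk hN4 c hκ (h1 κ) ?_
    have e : ((q.src.shift q.μ).shift q.ν) κ = q.src κ + 1 := by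
      rcases hin with rfl | rfl
      · exact shift_shift_apply_left q.src hμν
      · exact shift_shift_apply_right q.src hμν
    rw [← e]; exact h2 κ
  unfold GaugeField.plaqHol
  by_cases hμ : q.μ = c.dir
  · -- ν is transverse: the ν-bonds are trivial; the μ-bonds agree
    have hν : q.ν ≠ c.dir := fun h => hμν (hμ.trans h.symm)
    have hnν := hnl q.ν hν (Or.inr rfl)
    have e2 : iterSec k V ⟨q.src.shift q.μ, q.ν⟩ = 1 :=
      TubeStart.iterSec_apply_of_not_last hk V _ _ (by rw [B10StarCount.shift_apply_ne _ (Ne.symm hμν)]; exact hnν)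
    have e4 : iterSec k V ⟨q.src, q.ν⟩ = 1 := TubeStart.iterSec_apply_of_not_last hk V _ _ hnν
    by_cases hl : (q.src q.μ).val % P.L ^ k = P.L ^ k - 1
    · have e1 : iterSec k V ⟨q.src, q.μ⟩ = V ⟨coarsen k q.src, q.μ⟩ := TubeStart.iterSec_apply_of_last hk V _ _ hl
      have e3 : iterSec k V ⟨q.src.shift q.ν, q.μ⟩ = V ⟨coarsen k q.src, q.μ⟩ := by
        rw [TubeStart.iterSec_apply_of_last hk V _ _ (by rw [B10StarCount.shift_apply_ne _ hμν]; exact hl), AvgIterLocality.coarsen_eq_iterBlockOf,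
          Prop7AxialLemma1.iterBlockOf_shift_of_not_face hk q.src q.ν hnν, ← AvgIterLocality.coarsen_eq_iterBlockOf]
      rw [e1, e2, e3, e4]; group
    · have e1 : iterSec k V ⟨q.src, q.μ⟩ = 1 := TubeStart.iterSec_apply_of_not_last hk V _ _ hl
      have e3 : iterSec k V ⟨q.src.shift q.ν, q.μ⟩ = 1 := TubeStart.iterSec_apply_of_not_last hk V _ _ (by rw [B10StarCount.shift_apply_ne _ hμν]; exact hl)
      rw [e1, e2, e3, e4]; group
  · -- μ is transverse: the μ-bonds are trivial; the ν-bonds agree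
    have hnμ := hnl q.μ hμ (Or.inl rfl)
    have e1 : iterSec k V ⟨q.src, q.μ⟩ = 1 := TubeStart.iterSec_apply_of_not_last hk V _ _ hnμ
    have e3 : iterSec k V ⟨q.src.shift q.ν, q.μ⟩ = 1 :=
      TubeStart.iterSec_apply_of_not_last hk V _ _ (by rw [B10StarCount.shift_apply_ne _ hμν]; exact hnμ)
    by_cases hl : (q.src q.ν).val % P.L ^ k = P.L ^ k - 1
    · have e4 : iterSec k V ⟨q.src, q.ν⟩ = V ⟨coarsen k q.src, q.ν⟩ := TubeStart.iterSec_apply_of_last hk V _ _ hl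
      have e2 : iterSec k V ⟨q.src.shift q.μ, q.ν⟩ = V ⟨coarsen k q.src, q.ν⟩ := by
        rw [TubeStart.iterSec_apply_of_last hk V _ _ (by rw [B10StarCount.shift_apply_ne _ (Ne.symm hμν)]; exact hl), AvgIterLocality.coarsen_eq_iterBlockOf,
          Prop7AxialLemma1.iterBlockOf_shift_of_not_face hk q.src q.μ hnμ, ← AvgIterLocality.coarsen_eq_iterBlockOf]
      rw [e1, e2, e3, e4]; group
    · have e4 : iterSec k V ⟨q.src, q.ν⟩ = 1 := TubeStart.iterSec_apply_of_not_last hk V _ _ hl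
      have e2 : iterSec k V ⟨q.src.shift q.μ, q.ν⟩ = 1 :=
        TubeStart.iterSec_apply_of_not_last hk V _ _ (by rw [B10StarCount.shift_apply_ne _ (Ne.symm hμν)]; exact hl)
      rw [e1, e2, e3, e4]; group

end Flat

/-! ## §4 (S6) on the two-cell box: only the START's own facts remain -/

section Main

variable {n : Type*} [Fintype n] [DecidableEq n] [Nonempty n]

/-- **★★★ (S6), TWO-CELL FORM — THE DEFECT OF THE START AGAINST THE DATUM** (`k ≤ m + K`, `4Lᵏ ≤ sitesPerDir 0`): if the finest field `U` has every plaquette with lower and upper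
corners in the two-cell product set of `c` within `b′` of `1`, and agrees with the section `iterSec k V` on the `Lᵏ` bonds of the straight centre line `ĉ₋ → ĉ₊`, then — under R1's
k-free rows at `δ := (d·⌊Lᵏ/2⌋ + Lᵏ)·b′` — `‖avg^k U(c)·V(c)* − 1‖ ≤ 2(d+1)Lᵏ·((d·⌊Lᵏ/2⌋ + Lᵏ)·b′)`; START v3: `b′ = 64εL^{−2k}` ⇒ `O(d²ε)`, k-free (memo §3 (D)).  The two remaining
binders are (S5)-4's `dist1_plaqHol_startU_le` on the box and `startU_apply_of_quiet` on the centre line. [cite: Balaban1985Variational, Thm 1 (8) p.279, (11)–(13) pp.279–280; Balaban1985Averaging, Prop. 4 (134)–(135) p.38, pp.24–25] -/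
theorem norm_startDefect_sub_one_le_twoCell {k : ℕ} (hk : k ≤ P.m + P.K) (hN4 : 4 * P.L ^ k ≤ P.sitesPerDir 0) (U : GaugeField P 0 (Matrix.specialUnitaryGroup n ℂ))
    (V : GaugeField P k (Matrix.specialUnitaryGroup n ℂ)) (c : PBond P k) {b' : ℝ} (hb' : 0 ≤ b')
    (hU : ∀ q : Plaq P 0, (∀ κ, q.src κ ∈ twoCellSet k c κ) → (∀ κ, ((q.src.shift q.μ).shift q.ν) κ ∈ twoCellSet k c κ) → dist1 (GaugeField.plaqHol U q) ≤ b')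
    (hline : ∀ t : ℕ, t < P.L ^ k → U ⟨(fun z : Site P 0 => z.shift c.dir)^[t] (toFine k c.src), c.dir⟩ = iterSec k V ⟨(fun z : Site P 0 => z.shift c.dir)^[t] (toFine k c.src), c.dir⟩)
    (hm : (((P.d : ℝ) + 1) * ((18 : ℝ) ^ P.d * (2 + ((P.d : ℝ) + 1) * (18 : ℝ) ^ P.d)) * (324 * (((P.d + 2) * P.L : ℕ) : ℝ) ^ 2) /
        ((P.L : ℝ) * ((P.L : ℝ) - 1))) * (((P.d : ℝ) + 1) * (P.L : ℝ) ^ k * (((P.d * (P.L ^ k / 2) + P.L ^ k : ℕ) : ℝ) * b')) ≤ 1)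
    (h32 : 32 * (((P.d + 2) * P.L : ℕ) : ℝ) * (((P.d : ℝ) + 1) * (P.L : ℝ) ^ k * (((P.d * (P.L ^ k / 2) + P.L ^ k : ℕ) : ℝ) * b')) ≤ 1)
    (hN : 4 * (((P.d + 2) * P.L : ℕ) : ℝ) * (((P.d : ℝ) + 1) * (P.L : ℝ) ^ k * (((P.d * (P.L ^ k / 2) + P.L ^ k : ℕ) : ℝ) * b')) < deltaSU n) :
    ‖((Averaging.iter (fun i => (blockAvg (expMeanLogSU (n := n)) : Averaging P i (Matrix.specialUnitaryGroup n ℂ))) k U c :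
        Matrix.specialUnitaryGroup n ℂ) : Matrix n n ℂ) * star ((V c : Matrix.specialUnitaryGroup n ℂ) : Matrix n n ℂ) - 1‖ ≤
      2 * (((P.d : ℝ) + 1) * (P.L : ℝ) ^ k * (((P.d * (P.L ^ k / 2) + P.L ^ k : ℕ) : ℝ) * b')) := by
  have hN2 : ((P.L ^ k : ℕ) : ℤ) * 2 ≤ (P.sitesPerDir 0 : ℤ) := by exact_mod_cast (show P.L ^ k * 2 ≤ P.sitesPerDir 0 by omega)
  refine norm_startDefect_sub_one_le_of_box hk U V c (I := twoCellSet k c) hb' (fun q hq hq' => hU q hq hq') (fun q hq hq' => ?_)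
    (fun x hx μ => hwrap_twoCell hk hN4 c x hx μ) (fun x hx μ hxμ κ t ht1 ht2 => hfan_twoCell hk hN4 c x hx μ hxμ κ t ht1 ht2) (fun x hx => hl1_twoCell hk hN4 c x hx)
    (axialT_centre_congr hk hN2 U (iterSec k V) c hline) hm h32 hN
  rw [plaqHol_iterSec_eq_one_of_twoCell hk hN4 c V q hq hq', GaugeGroup.dist1_one]

end Main

end Summit.QuantumFields.YangMills.Theorems.StartDefectBox
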